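import Literature.AnabelianGeometry.EtaleTheta.LogDivisorModelTateTowerKummerTwistCompat

/-!
# [EtTh] Def. 3.3 (ii)/(iii) v2: level INFLATION `μ_{M_i} ↪ μ_{M_j}` for the ζ-twisted Kummer–Tate tower, equivariant exactly
# on the compatible group

S. Mochizuki, *The étale theta function …*, Publ. RIMS **45** (2009) [MochizukiEtTh2009], §1 p.13 (`K_N ⊆ K_{N'}` for `N ∣ N'`: the
roots of unity of one level are roots of unity of every deeper level), §3 Def. 3.3 (ii)–(iii) p.73 (the pull-back of functions
along `Z_∞^{(j)} → Z_∞^{(i)}`) [cite: MochizukiEtTh2009, Def 3.3 (iii) p.73].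

CLASS (b) DESIGN MODEL, sequel (b″) of `LogDivisorModelTateTowerKummerTwistGroup.lean` / `…Compat.lean` (abc-iut cell, layer L2, row
R677/R689 «ζ-TWISTED KUMMER ACTION ON THE TATE TOWER»; seat abc-iut-L1-t6 g4).  Plumbing for piece (d) (the `LogDivisorTower` over
`TateTowerKummerTwist.Compat`): the μ-COORDINATE of the transition maps.  With `M_i = (i+2)!` and `e := M_j/M_i` for `i ≤ j`:
* `inflate h : ℤ/M_i →+ ℤ/M_j`, `x ↦ e·x̃` — the inclusion `μ_{M_i} ⊂ μ_{M_j}` read on exponents (`ζ_{M_i}^x = ζ_{M_j}^{e x}`);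
  `inflate_intCast`, `inflate_res` (`inflate (res y) = e·y`), `res_inflate`, `inflate_injective`, `inflate_refl`, `inflate_trans`;
* **`inflate_smul_iff_res_eq`** — for units `u_i`, `u_j` of the two levels, `inflate (u_i·x) = u_j·inflate x` for all `x` IFF
  `res u_j = u_i`: the pull-back of roots of unity is equivariant for the cyclotomic twist EXACTLY when the character values are
  compatible — the reason piece (d) lives over `compat` (`inflate_chi_smul` for `g ∈ Compat`);
* `resFnTwist h : Multiplicative (ℤ/M_i × ℤ × ℤ) →* Multiplicative (ℤ/M_j × ℤ × ℤ)`, `(a, c, k) ↦ (inflate a, e c, e k)` — the pull-back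
  of the functions `μ_{M_i} × ⟨ϖ^{1/M_i}⟩ × ⟨U^{1/M_i}⟩` of level `i` to level `j` (`ϖ^{1/M_i} = (ϖ^{1/M_j})^e`), with the three
  `LogDivisorTower.resFn` laws: `resFnTwist_refl`, `resFnTwist_trans`, `resFnTwist_injective`.
HONEST LABEL: design-model plumbing, not the genuine tempered tower; nothing here bears on [IUTchIII] Cor. 3.12; typed ≠ proved.
-/

noncomputable section

namespace Literature.AnabelianGeometry.EtaleTheta

namespace TateTowerKummerTwist

open Function

/-! ## The ratio `e = M_j / M_i` -/

/-- `M_i · (M_j / M_i) = M_j` for `i ≤ j`. [cite: MochizukiEtTh2009, Def 3.3 (ii) p.73] -/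
theorem M_mul_div {i j : ℕ} (h : i ≤ j) : M i * (M j / M i) = M j := Nat.mul_div_cancel' (M_dvd h)

/-- `M_j / M_i ≠ 0`. [cite: MochizukiEtTh2009, Def 3.3 (ii) p.73] -/
theorem M_div_pos {i j : ℕ} (h : i ≤ j) : 0 < M j / M i :=
  Nat.div_pos (Nat.le_of_dvd (Nat.factorial_pos _) (M_dvd h)) (Nat.factorial_pos _)

/-- Transitivity of the ratios: `(M_j/M_i)(M_k/M_j) = M_k/M_i`. [cite: MochizukiEtTh2009, Def 3.3 (ii) p.73] -/
theorem M_div_mul_M_div {i j k : ℕ} (hij : i ≤ j) (hjk : j ≤ k) : M j / M i * (M k / M j) = M k / M i := by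
  have hi : 0 < M i := Nat.factorial_pos _
  refine Nat.eq_of_mul_eq_mul_left hi ?_
  rw [← mul_assoc, M_mul_div hij, M_mul_div hjk, M_mul_div (hij.trans hjk)]

/-! ## Inflation `ℤ/M_i →+ ℤ/M_j` -/

/-- The additive map `ℤ → ℤ/M_j`, `z ↦ (M_j/M_i)·z`; it kills `M_i`. [cite: MochizukiEtTh2009, §1 p.13] -/
theorem mulCast_apply_M {i j : ℕ} (h : i ≤ j) :
    ((AddMonoidHom.mulLeft (((M j / M i : ℕ) : ZMod (M j)))).comp (Int.castAddHom (ZMod (M j)))) (M i : ℕ) = 0 := by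
  change ((M j / M i : ℕ) : ZMod (M j)) * ((M i : ℕ) : ℤ) = 0
  rw [Int.cast_natCast, ← Nat.cast_mul, mul_comm, M_mul_div h, ZMod.natCast_self]

/-- **Inflation `ℤ/M_i →+ ℤ/M_j`** (`i ≤ j`): `x ↦ (M_j/M_i)·x̃` for any lift `x̃` — the inclusion `μ_{M_i} ⊂ μ_{M_j}` on exponents.
[cite: MochizukiEtTh2009, §1 p.13] -/
def inflate {i j : ℕ} (h : i ≤ j) : ZMod (M i) →+ ZMod (M j) :=
  ZMod.lift (M i) ⟨(AddMonoidHom.mulLeft (((M j / M i : ℕ) : ZMod (M j)))).comp (Int.castAddHom (ZMod (M j))), mulCast_apply_M h⟩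

/-- `inflate` on an integer. [cite: MochizukiEtTh2009, §1 p.13] -/
theorem inflate_intCast {i j : ℕ} (h : i ≤ j) (z : ℤ) : inflate h (z : ZMod (M i)) = ((M j / M i : ℕ) : ZMod (M j)) * z :=
  ZMod.lift_coe (M i) _ z

/-- **`inflate (res y) = (M_j/M_i)·y`**: going down then up multiplies by the ratio. [cite: MochizukiEtTh2009, §1 p.13] -/
theorem inflate_res {i j : ℕ} (h : i ≤ j) (y : ZMod (M j)) : inflate h (res h y) = ((M j / M i : ℕ) : ZMod (M j)) * y := by
  obtain ⟨z, rfl⟩ := ZMod.intCast_surjective y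
  rw [map_intCast, inflate_intCast]

/-- `res (inflate x) = (M_j/M_i)·x`. [cite: MochizukiEtTh2009, §1 p.13] -/
theorem res_inflate {i j : ℕ} (h : i ≤ j) (x : ZMod (M i)) : res h (inflate h x) = ((M j / M i : ℕ) : ZMod (M i)) * x := by
  obtain ⟨z, rfl⟩ := ZMod.intCast_surjective x
  rw [inflate_intCast, map_mul, map_natCast, map_intCast]

/-- **`inflate` is injective** (`μ_{M_i} ⊂ μ_{M_j}`): `(M_j/M_i)·z ≡ 0 (mod M_j)` forces `z ≡ 0 (mod M_i)`.
[cite: MochizukiEtTh2009, §1 p.13] -/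
theorem inflate_injective {i j : ℕ} (h : i ≤ j) : Injective (inflate h) := by
  rw [inflate, ZMod.lift_injective]
  intro m hm
  change ((M j / M i : ℕ) : ZMod (M j)) * (m : ZMod (M j)) = 0 at hm
  rw [← Int.cast_natCast, ← Int.cast_mul, ZMod.intCast_zmod_eq_zero_iff_dvd] at hm
  rw [ZMod.intCast_zmod_eq_zero_iff_dvd]
  have hM : ((M j : ℕ) : ℤ) = (M j / M i : ℕ) * (M i : ℕ) := by rw [← Nat.cast_mul, mul_comm, M_mul_div h]
  rw [hM] at hm
  exact Int.dvd_of_mul_dvd_mul_left (by exact_mod_cast (M_div_pos h).ne') hm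

/-- `inflate` along `i ≤ i` is the identity. [cite: MochizukiEtTh2009, §1 p.13] -/
theorem inflate_refl (i : ℕ) (x : ZMod (M i)) : inflate (le_refl i) x = x := by
  obtain ⟨z, rfl⟩ := ZMod.intCast_surjective x
  rw [inflate_intCast, Nat.div_self (Nat.factorial_pos _), Nat.cast_one, one_mul]

/-- `inflate` is transitive. [cite: MochizukiEtTh2009, §1 p.13] -/
theorem inflate_trans {i j k : ℕ} (hij : i ≤ j) (hjk : j ≤ k) (x : ZMod (M i)) :
    inflate hjk (inflate hij x) = inflate (hij.trans hjk) x := by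
  obtain ⟨z, rfl⟩ := ZMod.intCast_surjective x
  rw [inflate_intCast, ← Int.cast_natCast, ← Int.cast_mul, inflate_intCast, inflate_intCast, Int.cast_mul, Int.cast_natCast,
    ← mul_assoc, ← Nat.cast_mul, mul_comm (M k / M j), M_div_mul_M_div hij hjk]

/-! ## Equivariance under the cyclotomic twist: exactly on compatible character values -/

/-- If `res u_j = u_i` then `inflate (u_i • x) = u_j • inflate x`. [cite: MochizukiEtTh2009, §1 p.13] -/
theorem inflate_smul_of_res_eq {i j : ℕ} (h : i ≤ j) {ui : (ZMod (M i))ˣ} {uj : (ZMod (M j))ˣ}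
    (hc : res h (uj : ZMod (M j)) = ui) (x : ZMod (M i)) : inflate h (ui • x) = uj • inflate h x := by
  obtain ⟨y, rfl⟩ := ZMod.castHom_surjective (M_dvd h) x
  change inflate h ((ui : ZMod (M i)) * res h y) = (uj : ZMod (M j)) * inflate h (res h y)
  rw [← hc, ← map_mul, inflate_res, inflate_res, mul_left_comm]

/-- Conversely, equivariance forces compatibility: if `inflate (u_i • x) = u_j • inflate x` for all `x` then `res u_j = u_i`.
[cite: MochizukiEtTh2009, §1 p.13] -/
theorem res_eq_of_inflate_smul {i j : ℕ} (h : i ≤ j) {ui : (ZMod (M i))ˣ} {uj : (ZMod (M j))ˣ}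
    (hc : ∀ x : ZMod (M i), inflate h (ui • x) = uj • inflate h x) : res h (uj : ZMod (M j)) = ui := by
  obtain ⟨w, hw⟩ := ZMod.castHom_surjective (M_dvd h) (ui : ZMod (M i))
  have h1 := hc 1
  rw [Units.smul_def, Units.smul_def, smul_eq_mul, smul_eq_mul, mul_one] at h1
  have e1 : inflate h (1 : ZMod (M i)) = ((M j / M i : ℕ) : ZMod (M j)) := by
    rw [← (res h).map_one, inflate_res, mul_one]
  change res h w = (ui : ZMod (M i)) at hw
  rw [← hw, inflate_res, e1] at h1
  -- `e·w = u_j·e` in `ℤ/M_j`, hence `inflate (res w) = inflate (res u_j)` and `res w = res u_j`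
  have h2 : inflate h (res h w) = inflate h (res h (uj : ZMod (M j))) := by
    rw [inflate_res, inflate_res, h1, mul_comm]
  rw [← hw]
  exact ((inflate_injective h) h2).symm

/-- **Equivariance ⟺ compatibility.** [cite: MochizukiEtTh2009, §1 p.13] -/
theorem inflate_smul_iff_res_eq {i j : ℕ} (h : i ≤ j) (ui : (ZMod (M i))ˣ) (uj : (ZMod (M j))ˣ) :
    (∀ x : ZMod (M i), inflate h (ui • x) = uj • inflate h x) ↔ res h (uj : ZMod (M j)) = ui :=
  ⟨res_eq_of_inflate_smul h, fun hc => inflate_smul_of_res_eq h hc⟩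

/-- For `g` in the COMPATIBLE group, inflation is equivariant for the cyclotomic twist by `g` (character values `χ_i(g)`,
`χ_j(g)`). [cite: MochizukiEtTh2009, §1 p.13] -/
theorem inflate_chi_smul {i j : ℕ} (h : i ≤ j) (g : Compat) (x : ZMod (M i)) :
    inflate h ((g : Grp).1.right i • x) = (g : Grp).1.right j • inflate h x :=
  inflate_smul_of_res_eq h (by
    have hc := congrArg Units.val (g.2.2 i j h)
    rw [Units.coe_map] at hc
    exact hc) x

/-- For `g` in the compatible group, the Kummer coordinates inflate by the ratio: `inflate (k_i) = (M_j/M_i)·k_j` (both coordinates).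
[cite: MochizukiEtTh2009, Def 3.3 (ii) p.73] -/
theorem inflate_kummer_fst {i j : ℕ} (h : i ≤ j) (g : Compat) :
    inflate h ((g : Grp).1.left.toAdd i).1 = ((M j / M i : ℕ) : ZMod (M j)) * ((g : Grp).1.left.toAdd j).1 := by
  rw [← g.2.1 i j h]
  exact inflate_res h _

/-- The second Kummer coordinate inflates by the ratio. [cite: MochizukiEtTh2009, Def 3.3 (ii) p.73] -/
theorem inflate_kummer_snd {i j : ℕ} (h : i ≤ j) (g : Compat) :
    inflate h ((g : Grp).1.left.toAdd i).2 = ((M j / M i : ℕ) : ZMod (M j)) * ((g : Grp).1.left.toAdd j).2 := by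
  rw [← g.2.1 i j h]
  exact inflate_res h _

/-! ## The transition on functions `μ_{M_i} × ⟨ϖ^{1/M_i}⟩ × ⟨U^{1/M_i}⟩ → μ_{M_j} × ⟨ϖ^{1/M_j}⟩ × ⟨U^{1/M_j}⟩` -/

/-- The additive transition on exponents: `(a, c, k) ↦ (inflate a, e c, e k)`, `e = M_j/M_i`.
[cite: MochizukiEtTh2009, Def 3.3 (iii) p.73] -/
def resExp {i j : ℕ} (h : i ≤ j) : ZMod (M i) × ℤ × ℤ →+ ZMod (M j) × ℤ × ℤ :=
  (inflate h).prodMap (((M j / M i : ℕ) : ℤ) • AddMonoidHom.id (ℤ × ℤ))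

/-- `resExp` on components. [cite: MochizukiEtTh2009, Def 3.3 (iii) p.73] -/
theorem resExp_apply {i j : ℕ} (h : i ≤ j) (a : ZMod (M i)) (c k : ℤ) :
    resExp h (a, c, k) = (inflate h a, ((M j / M i : ℕ) : ℤ) * c, ((M j / M i : ℕ) : ℤ) * k) := by
  simp only [resExp, AddMonoidHom.prodMap, AddMonoidHom.prod_apply, AddMonoidHom.coe_comp, comp_apply, AddMonoidHom.coe_fst,
    AddMonoidHom.coe_snd, AddMonoidHom.smul_apply, AddMonoidHom.id_apply, Prod.smul_mk, smul_eq_mul]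

/-- **The pull-back of functions along `Z_∞^{(j)} → Z_∞^{(i)}`** for the ζ-twisted tower: `ζ^a ϖ_i^c U_i^k ↦ ζ^{e ã} ϖ_j^{e c} U_j^{e k}`
(`ϖ_i = ϖ_j^e`, `U_i = U_j^e`, `μ_{M_i} ⊂ μ_{M_j}`). [cite: MochizukiEtTh2009, Def 3.3 (iii) p.73] -/
def resFnTwist {i j : ℕ} (h : i ≤ j) : Multiplicative (ZMod (M i) × ℤ × ℤ) →* Multiplicative (ZMod (M j) × ℤ × ℤ) :=
  AddMonoidHom.toMultiplicative (resExp h)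

/-- `resFnTwist` on exponents. [cite: MochizukiEtTh2009, Def 3.3 (iii) p.73] -/
theorem toAdd_resFnTwist {i j : ℕ} (h : i ≤ j) (f : Multiplicative (ZMod (M i) × ℤ × ℤ)) :
    (resFnTwist h f).toAdd = resExp h f.toAdd := rfl

/-- **Law `resFn_refl`**: the transition along `i ≤ i` is the identity. [cite: MochizukiEtTh2009, Def 3.3 (iii) p.73] -/
theorem resFnTwist_refl (i : ℕ) (f : Multiplicative (ZMod (M i) × ℤ × ℤ)) : resFnTwist (le_refl i) f = f := by
  obtain ⟨⟨a, c, k⟩, rfl⟩ := Multiplicative.ofAdd.surjective f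
  refine Multiplicative.toAdd.injective ?_
  rw [toAdd_resFnTwist, toAdd_ofAdd, resExp_apply, inflate_refl, Nat.div_self (Nat.factorial_pos _), Nat.cast_one,
    one_mul, one_mul]

/-- **Law `resFn_trans`**: transitions compose. [cite: MochizukiEtTh2009, Def 3.3 (iii) p.73] -/
theorem resFnTwist_trans {i j k : ℕ} (hij : i ≤ j) (hjk : j ≤ k) (f : Multiplicative (ZMod (M i) × ℤ × ℤ)) :
    resFnTwist (hij.trans hjk) f = resFnTwist hjk (resFnTwist hij f) := by
  obtain ⟨⟨a, c, m⟩, rfl⟩ := Multiplicative.ofAdd.surjective f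
  refine Multiplicative.toAdd.injective ?_
  rw [toAdd_resFnTwist, toAdd_resFnTwist, toAdd_resFnTwist, toAdd_ofAdd, resExp_apply, resExp_apply, resExp_apply,
    inflate_trans hij hjk, ← mul_assoc, ← mul_assoc, ← Nat.cast_mul, mul_comm (M k / M j), M_div_mul_M_div hij hjk]

/-- **Law `resFn_injective`**: the pull-back of functions is injective (dominant covering).
[cite: MochizukiEtTh2009, Def 3.3 (iii) p.73] -/
theorem resFnTwist_injective {i j : ℕ} (h : i ≤ j) : Injective (resFnTwist h) := by
  intro f g hfg
  obtain ⟨⟨a, c, k⟩, rfl⟩ := Multiplicative.ofAdd.surjective f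
  obtain ⟨⟨a', c', k'⟩, rfl⟩ := Multiplicative.ofAdd.surjective g
  have h1 := congrArg Multiplicative.toAdd hfg
  rw [toAdd_resFnTwist, toAdd_resFnTwist, toAdd_ofAdd, toAdd_ofAdd, resExp_apply, resExp_apply] at h1
  obtain ⟨ha, hck⟩ := Prod.ext_iff.1 h1
  obtain ⟨hc, hk⟩ := Prod.ext_iff.1 hck
  have he : ((M j / M i : ℕ) : ℤ) ≠ 0 := by exact_mod_cast (M_div_pos h).ne'
  rw [inflate_injective h ha, mul_left_cancel₀ he hc, mul_left_cancel₀ he hk]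

end TateTowerKummerTwist

end Literature.AnabelianGeometry.EtaleTheta

end
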